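import Summits.AtomisticToContinuum.HydrodynamicLimit.Theorems.CollisionIsometryCLTCollisionalTransferLocalityDefs
import Literature.Analysis.FunctionSpaces.TorusFluidGlueProofs
import HarnessLib

/-!
# FTC for the slice integrals of a smooth space–time test on `𝕋³`
(line `hemisphere-affine-slaving`, crux `CollisionalTransferLocality`, stmt-AtomisticToContinuum-9518)

Helper file (`--supports stmt-AtomisticToContinuum-9518`; registered stub
`integral_slice_sub_eq_setIntegral_timeDeriv`, equilibrium rung) of the line lead. At equilibrium the
one-time pieces of the crux's residual converge to `(3θ/2)∫ₓ χ(τ,·)`, `(3θ/2)∫ₓ χ(0,·)` and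
`∫₀^τ (3θ/2)∫ₓ ∂ₛχ(s,·) ds`; the deterministic identity that makes them cancel is the fundamental
theorem of calculus for the space integrals `I(s) = ∫ₓ χ(s, x) dx` of a test `χ` jointly smooth on
`[0, t] × 𝕋³`:
`∫ₓ χ(τ,·) - ∫ₓ χ(0,·) = ∫_{[0,τ]} ∫ₓ ∂ₛχ(s,·) ds` for `τ ∈ [0, t]`.

Proof: `I` has the one-sided derivative `I'(s) = ∫ₓ ∂ₛχ(s, x) dx` within `[0, t]` at every
`s ∈ [0, t]` (differentiation under `∫_{𝕋³}`, `Torus.IsSmoothSpaceTimeOn.hasDerivWithinAt_integral`),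
`I'` is continuous on `[0, t]` (`Torus.IsSmoothSpaceTimeOn.continuousOn_integral_timeDerivWithin`),
so FTC-2 (`intervalIntegral.integral_eq_sub_of_hasDerivAt_of_le`) gives `∫₀^τ I' = I τ - I 0`; on the
open interval `(0, τ)` the one-sided time derivative within `[0, t]` is the two-sided one
(`Torus.timeDerivWithin_of_mem_interior`), and the endpoints are Lebesgue-null
(`integral_Icc_eq_integral_Ioo`).
References: W. Rudin, *Principles of Mathematical Analysis* (3rd ed., 1976), Thm. 6.21 (FTC) and
Thm. 9.42 (differentiation under the integral sign).
-/

namespace Summit.AtomisticToContinuum.HydrodynamicLimit.Theorems.HemisphereAffineSlaving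

open scoped BigOperators Topology Classical ENNReal InnerProductSpace
open Filter Set Function MeasureTheory
open Literature.Analysis.FunctionSpaces

noncomputable section

open Literature.MathematicalPhysics.KineticTheory (T3 V3)

/-- FTC for slice integrals of a jointly smooth space–time test `χ` on `[0, t] × 𝕋³`:
`∫ₓ χ(τ,·) - ∫ₓ χ(0,·) = ∫_{s ∈ [0,τ]} ∫ₓ ∂ₛχ(s,·)` for every `τ ∈ [0, t]` (the two-sided time
derivative `Torus.timeDeriv` agrees with the derivative within `[0, t]` on `(0, τ)`, and `{0, τ}` is
null). -/
theorem integral_slice_sub_eq_setIntegral_timeDeriv : ∀ {t : ℝ} {χ : ℝ → T3 → ℝ}, 0 < t → Literature.Analysis.FunctionSpaces.Torus.IsSmoothSpaceTimeOn (Icc 0 t) χ → ∀ τ ∈ Icc 0 t, (∫ x, χ τ x) - (∫ x, χ 0 x) = ∫ s in Icc 0 τ, ∫ x, Literature.Analysis.FunctionSpaces.Torus.timeDeriv χ s x := by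
  intro t χ ht hχ τ hτ
  have hU : UniqueDiffOn ℝ (Icc 0 t) := uniqueDiffOn_Icc ht
  have hτ0 : (0 : ℝ) ≤ τ := hτ.1
  have hsub : Icc 0 τ ⊆ Icc 0 t := Icc_subset_Icc_right hτ.2
  -- (1) differentiation under `∫_{𝕋³}` within `[0, t]`, and continuity of the derivative
  have hder : ∀ s ∈ Icc 0 t, HasDerivWithinAt (fun s => ∫ x, χ s x)
      (∫ x, Torus.timeDerivWithin (Icc 0 t) χ s x) (Icc 0 t) s := fun s hs =>
    hχ.hasDerivWithinAt_integral (convex_Icc 0 t) hs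
  have hcont : ContinuousOn (fun s => ∫ x, Torus.timeDerivWithin (Icc 0 t) χ s x) (Icc 0 t) :=
    hχ.continuousOn_integral_timeDerivWithin hU
  -- (2) FTC-2 on `[0, τ]`
  have hFTC : ∫ s in (0 : ℝ)..τ, (∫ x, Torus.timeDerivWithin (Icc 0 t) χ s x) =
      (∫ x, χ τ x) - ∫ x, χ 0 x :=
    intervalIntegral.integral_eq_sub_of_hasDerivAt_of_le (f := fun s => ∫ x, χ s x) hτ0
      (fun s hs => ((hder s (hsub hs)).continuousWithinAt).mono hsub)
      (fun s hs => (hder s ⟨hs.1.le, hs.2.le.trans hτ.2⟩).hasDerivAt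
        (Icc_mem_nhds hs.1 (hs.2.trans_le hτ.2)))
      ((hcont.mono ((uIcc_of_le hτ0).subset.trans hsub)).intervalIntegrable)
  -- (3) `[0, τ] → (0, τ)` (null endpoints), where the within- and two-sided derivatives agree
  rw [← hFTC, intervalIntegral.integral_of_le hτ0, integral_Ioc_eq_integral_Ioo,
    integral_Icc_eq_integral_Ioo]
  refine setIntegral_congr_fun measurableSet_Ioo fun s hs => ?_
  have hint : s ∈ interior (Icc 0 t) := by
    rw [interior_Icc]
    exact ⟨hs.1, hs.2.trans_le hτ.2⟩
  exact integral_congr_ae (ae_of_all _ fun x => Torus.timeDerivWithin_of_mem_interior hint x)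

end

end Summit.AtomisticToContinuum.HydrodynamicLimit.Theorems.HemisphereAffineSlaving
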